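import Summits.Ventures.PercRepro.RankLevelSetUpFiveRankFiveSort

/-! # RankLevelSetUpFiveRankFive — (↑) AT LEVEL `5` ON NULLITY `5` ALONG A SERIES CLASS OF SIZE `≥ 3`: THE
CLASS-CUT AT THE BASIS LEVEL OF A RANK-`5` DUAL (night-1 g40; dossier §52.14; on `RankLevelSetUpFiveRankFiveSort`)

With the sorts of `RankLevelSetUpFiveRankFiveSort`, cutting the class to two elements and using (↑)₅ of the cut
matroid (the hypothesis `hih` on the contractions `M ／ D`; the exact middle when `#E' = 9`) with `g_4 ≤ ḡ_5` closes
`T_5(N) = T_5(N'') + (q − 2) g_4 ≤ V_6(N'') + (q − 2) g_4 ≤ Ā_6 + 2 ḡ_5 + ḡ_4 + (q − 2) ḡ_5 ≤ V_6(N)`; for `#E' ≤ 8`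
the families are small and `C(q,2) ≥ q` suffices. Hence **`upAt_five_of_seriesClass_rank_five`** (`b` outside the
class) and **`upAt_five_of_mem_seriesClass_rank_five`** (`b` inside: `T_5 ≤ 𝒢_4 ≤ C(q−1,2) 𝒢_4 ≤ V_6`). Every
declaration has a docstring; imports: the cell's own modules and Mathlib only. Axioms: standard. -/

namespace PercRepro

open Set Matroid

variable {α : Type} (M : Matroid α) [M.Finite]


/-- **(↑) AT LEVEL `5` AT AN ELEMENT OF A SERIES CLASS OF SIZE `≥ 3` ON NULLITY `5`** (`M` coloop-free): a basis
through `b ∈ P` meets `P` in `{b}`, so `W ↦ W ∖ P` injects `T_5` into `𝒢_4 = avoidHat M✶ p b 4` (the bi-spanning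
`4`-sets of the contraction), and `C(q−1,2) · 𝒢_4 ≤ V_6` (`avoid_six_ge_of_mem`). -/
theorem upAt_five_of_mem_seriesClass_rank_five (hcol : ∀ e, ¬ M.IsColoop e) (hν : M✶.eRank = 5) {p : α}
    (hp : p ∈ M.E) (hq : 3 ≤ (M✶.closure {p}).ncard) {b : α} (hbP : b ∈ M✶.closure {p}) :
    BiIndepUpAt M b 5 := by
  classical
  have hnl := dual_isNonloop_of_coloopFree' M hcol
  have hpE : p ∈ M✶.E := by rwa [Matroid.dual_ground]
  have hpnl : M✶.IsNonloop p := hnl p hpE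
  have hPE : M✶.closure {p} ⊆ M✶.E := M✶.closure_subset_ground _
  have hPfin : (M✶.closure {p}).Finite := M✶.ground_finite.subset hPE
  unfold BiIndepUpAt
  rw [biIndep_eq_biSpan_dual, biIndep_eq_biSpan_dual]
  -- `T_5 ≤ 𝒢_4` by `W ↦ W ∖ P`
  have hT : {W ∈ biSpan M✶ 5 | b ∈ W}.ncard ≤ (avoidHat M✶ p b 4).ncard := by
    refine Set.ncard_le_ncard_of_injOn (fun W => W \ M✶.closure {p}) ?_ ?_ (avoidHat_finite M✶ p b 4)
    · rintro W ⟨⟨hWE, hW5, hWs, hWc⟩, hbW⟩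
      have hWfin : W.Finite := M✶.ground_finite.subset hWE
      have hsing : W ∩ M✶.closure {p} = {b} := by
        ext y
        constructor
        · intro hy
          by_contra hyb
          exact not_two_parallel_of_spanning_five_rank_five hnl hν hWs hW5 (p := p) hy.1 hbW
            (fun h => hyb (by rw [Set.mem_singleton_iff]; exact h)) hy.2 hbP
        · intro hy; rw [Set.mem_singleton_iff] at hy; rw [hy]; exact ⟨hbW, hbP⟩
      have hc1 : (W ∩ M✶.closure {p}).ncard = 1 := by rw [hsing, Set.ncard_singleton]
      refine ⟨fun x hx => ⟨hWE hx.1, hx.2⟩, ?_, fun h => h.2 hbP, ?_, ?_⟩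
      · have h := Set.ncard_inter_add_ncard_sdiff_eq_ncard W (M✶.closure {p}) hWfin
        omega
      · have hW' : W = (W \ M✶.closure {p}) ∪ (W ∩ M✶.closure {p}) := by rw [Set.sdiff_union_inter]
        rw [hW'] at hWs
        exact (spanning_union_iff_insert M✶ hnl hpnl Set.inter_subset_right ⟨b, hbW, hbP⟩
          (Set.sdiff_subset.trans hWE)).mp hWs
      · rw [compl_eq_sdiff_union M✶ hPE] at hWc
        have hne : (M✶.closure {p} \ W).Nonempty := by
          by_contra hemp
          rw [Set.not_nonempty_iff_eq_empty, Set.sdiff_eq_empty] at hemp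
          have : M✶.closure {p} ⊆ W ∩ M✶.closure {p} := fun y hy => ⟨hemp hy, hy⟩
          have hle := Set.ncard_le_ncard this (hWfin.subset Set.inter_subset_left)
          omega
        exact (spanning_union_iff_insert M✶ hnl hpnl Set.sdiff_subset hne
          (Set.sdiff_subset.trans Set.sdiff_subset)).mp hWc
    · rintro W ⟨⟨hWE, hW5, hWs, -⟩, hbW⟩ W' ⟨⟨hW'E, hW'5, hW's, -⟩, hbW'⟩ heq
      simp only at heq
      have hsing : ∀ (X : Set α), X ⊆ M✶.E → X.ncard = 5 → M✶.Spanning X → b ∈ X →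
          X ∩ M✶.closure {p} = {b} := by
        intro X hXE hX5 hXs hbX
        ext y
        constructor
        · intro hy
          by_contra hyb
          exact not_two_parallel_of_spanning_five_rank_five hnl hν hXs hX5 (p := p) hy.1 hbX
            (fun h => hyb (by rw [Set.mem_singleton_iff]; exact h)) hy.2 hbP
        · intro hy; rw [Set.mem_singleton_iff] at hy; rw [hy]; exact ⟨hbX, hbP⟩
      rw [← Set.inter_union_sdiff W (M✶.closure {p}), ← Set.inter_union_sdiff W' (M✶.closure {p}),
        hsing W hWE hW5 hWs hbW, hsing W' hW'E hW'5 hW's hbW', heq]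
  have hV := avoid_six_ge_of_mem M✶ hnl hpE hbP
  have hq' : 2 ≤ (M✶.closure {p} \ {b}).ncard := by
    rw [Set.ncard_sdiff_singleton_of_mem hbP]; omega
  have hc : 1 ≤ (M✶.closure {p} \ {b}).ncard.choose 2 := Nat.choose_pos hq'
  have hm : (avoidHat M✶ p b 4).ncard ≤
      (M✶.closure {p} \ {b}).ncard.choose 2 * (avoidHat M✶ p b 4).ncard := by
    calc (avoidHat M✶ p b 4).ncard = 1 * (avoidHat M✶ p b 4).ncard := (one_mul _).symm
      _ ≤ _ := Nat.mul_le_mul_right _ hc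
  show {W ∈ biSpan M✶ 5 | b ∈ W}.ncard ≤ {Z ∈ biSpan M✶ 6 | b ∉ Z}.ncard
  omega

/-- **(↑) AT LEVEL `5` OUTSIDE A SERIES CLASS OF SIZE `≥ 3` ON NULLITY `5`, FROM (↑)₅ ON THE MATROIDS WITH FEWER
ELEMENTS** (`M` coloop-free of nullity `5`, `p ∈ E` with `q = #cl✶ {p} ≥ 3`, `b ∉ cl✶ {p}`): the class is cut to
two elements (`M ／ (P ∖ {p, p'})`, nullity `5`, fewer elements: the hypothesis `hih` — (↑)₅ at `b` on the
contractions `M ／ D` by nonempty `D ⊆ P ∖ {p}` with `≥ 12` elements —, or the exact middle `#E'' = 11`) and `T_5(N) = T_5(N'') + (q − 2) g_4 ≤ V_6(N'') + (q − 2) g_4 ≤ Ā_6 + 2 ḡ_5 + ḡ_4 + (q − 2) ḡ_5 ≤ V_6(N)`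
with `g_4 ≤ ḡ_5` ((↑)₄ of the rank-`4` contraction for `#E' ≥ 10`, complementation at `#E' = 9`); for `#E' ≤ 8`
the families are small. -/
theorem upAt_five_of_seriesClass_rank_five (hcol : ∀ e, ¬ M.IsColoop e) (hν : M✶.eRank = 5) {p : α}
    (hp : p ∈ M.E) (hq : 3 ≤ (M✶.closure {p}).ncard) {b : α} (hb : b ∈ M.E) (hbP : b ∉ M✶.closure {p})
    (hih : ∀ (D : Set α), D ⊆ M✶.closure {p} → p ∉ D → D.Nonempty → 12 ≤ (M.contract D).E.ncard →
      BiIndepUpAt (M.contract D) b 5) :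
    BiIndepUpAt M b 5 := by
  classical
  have hnl := dual_isNonloop_of_coloopFree' M hcol
  have hpE : p ∈ M✶.E := by rwa [Matroid.dual_ground]
  have hbE : b ∈ M✶.E := by rwa [Matroid.dual_ground]
  have hPE : M✶.closure {p} ⊆ M✶.E := M✶.closure_subset_ground _
  have hpP : p ∈ M✶.closure {p} := M✶.mem_closure_of_mem' rfl hpE
  have hPfin : (M✶.closure {p}).Finite := M✶.ground_finite.subset hPE
  have hE'card : (M✶.E \ M✶.closure {p}).ncard + (M✶.closure {p}).ncard = M.E.ncard := by
    rw [Set.ncard_sdiff hPE (M.ground_finite.subset hPE), Matroid.dual_ground]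
    have := Set.ncard_le_ncard hPE M.ground_finite
    rw [Matroid.dual_ground] at this
    omega
  unfold BiIndepUpAt
  rw [biIndep_eq_biSpan_dual, biIndep_eq_biSpan_dual]
  have hT := through_five_eq_rank_five M✶ hnl hν hpE (by omega) hbP
  have hV := avoid_six_eq_rank_five_of_three_le M✶ hnl hν hpE hq hbP
  have hcomp : ∀ k, k ≤ (M✶.E \ M✶.closure {p}).ncard →
      (avoidHat M✶ p b k).ncard = (throughHat M✶ p b ((M✶.E \ M✶.closure {p}).ncard - k)).ncard :=
    fun k hk => avoidHat_ncard_eq_throughHat_compl M✶ hbE hbP hk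
  have hq2 : (M✶.closure {p}).ncard ≤ (M✶.closure {p}).ncard.choose 2 := le_choose_two _ hq
  rcases Nat.lt_or_ge (M✶.E \ M✶.closure {p}).ncard 8 with hlt8 | hge8
  · -- `#E' ≤ 7`: `T_5 = 0`
    rw [hT, upFull_five_eq_empty_rank_five M✶ hν (by omega), throughHat_four_eq_empty_rank_five M✶ hν (by omega),
      Set.ncard_empty]
    omega
  rcases Nat.lt_or_ge (M✶.E \ M✶.closure {p}).ncard 9 with hlt9 | hge9
  · -- `#E' = 8`: `A_5 = 0`, `ḡ_4 = g_4`, `C(q,2) ≥ q`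
    have e : (M✶.E \ M✶.closure {p}).ncard = 8 := by omega
    rw [hT, hV, upFull_five_eq_empty_rank_five M✶ hν (by omega), Set.ncard_empty, hcomp 4 (by omega), e]
    simp only [Nat.reduceSub]
    have hm : (M✶.closure {p}).ncard * (throughHat M✶ p b 4).ncard ≤
        (M✶.closure {p}).ncard.choose 2 * (throughHat M✶ p b 4).ncard := Nat.mul_le_mul_right _ hq2
    omega
  -- `#E' ≥ 9`: `g_4 ≤ ḡ_5`
  have hg4 : (throughHat M✶ p b 4).ncard ≤ (avoidHat M✶ p b 5).ncard := by
    rcases Nat.lt_or_ge (M✶.E \ M✶.closure {p}).ncard 10 with h9 | h10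
    · have e : (M✶.E \ M✶.closure {p}).ncard = 9 := by omega
      rw [hcomp 5 (by omega), e]
    · refine throughHat_four_le_avoidHat_five_rank_five M hcol hν hp hb hbP ?_
      rw [← Matroid.dual_ground]; exact h10
  -- the cut to two elements
  have hcut : ∀ (D : Set α), D ⊆ M✶.closure {p} → p ∉ D → D.Nonempty →
      (M.contract D)✶ = M✶.delete D ∧ (M.contract D).E.ncard = M.E.ncard - D.ncard ∧
      (M.contract D).E.ncard < M.E.ncard ∧ (M.contract D)✶.eRank ≤ 5 ∧ b ∈ (M.contract D).E ∧
      (M✶.delete D).closure {p} = M✶.closure {p} \ D := by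
    intro D hDP hpD hDne
    have hDE : D ⊆ M.E := by rw [← Matroid.dual_ground (M := M)]; exact hDP.trans hPE
    have hDfin : D.Finite := hPfin.subset hDP
    have hco : M✶.Coindep D := coindep_of_subset_closure_of_notMem M✶ hpE hDP hpD
    have hdual : (M.contract D)✶ = M✶.delete D := Matroid.dual_contract M D
    have hcard : (M.contract D).E.ncard = M.E.ncard - D.ncard := by
      rw [Matroid.contract_ground, Set.ncard_sdiff hDE hDfin]
    refine ⟨hdual, hcard, ?_, ?_, ?_, ?_⟩
    · rw [hcard]
      have := Set.ncard_le_ncard hDE M.ground_finite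
      have hpos : 0 < D.ncard := (Set.ncard_pos hDfin).mpr hDne
      omega
    · rw [hdual, eRank_delete_of_coindep M✶ hco, hν]
    · rw [Matroid.contract_ground]; exact ⟨hb, fun h => hbP (hDP h)⟩
    · rw [Matroid.delete_closure_eq_of_disjoint M✶ (Set.disjoint_singleton_left.mpr hpD)]
  have hfam : ∀ (D : Set α), D ⊆ M✶.closure {p} → p ∉ D →
      (∀ e ∈ (M✶.delete D).E, (M✶.delete D).IsNonloop e) ∧ (M✶.delete D).eRank = 5 ∧ p ∈ (M✶.delete D).E ∧
      b ∉ (M✶.delete D).closure {p} := by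
    intro D hDP hpD
    have hco : M✶.Coindep D := coindep_of_subset_closure_of_notMem M✶ hpE hDP hpD
    refine ⟨?_, by rw [eRank_delete_of_coindep M✶ hco, hν], ?_, ?_⟩
    · intro e he
      rw [Matroid.delete_ground] at he
      exact Matroid.delete_isNonloop_iff.mpr ⟨hnl e he.1, he.2⟩
    · rw [Matroid.delete_ground]; exact ⟨hpE, hpD⟩
    · rw [Matroid.delete_closure_eq_of_disjoint M✶ (Set.disjoint_singleton_left.mpr hpD)]
      exact fun h => hbP h.1
  obtain ⟨p', hp'⟩ : (M✶.closure {p} \ {p}).Nonempty := by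
    refine Set.nonempty_of_ncard_ne_zero ?_
    rw [Set.ncard_sdiff_singleton_of_mem hpP]; omega
  have hp'P : p' ∈ M✶.closure {p} := hp'.1
  have hp'p : p' ≠ p := fun h => hp'.2 (by rw [Set.mem_singleton_iff]; exact h)
  have hpair : ({p, p'} : Set α) ⊆ M✶.closure {p} := by
    intro x hx; rcases hx with rfl | hx
    · exact hpP
    · rw [Set.mem_singleton_iff] at hx; rw [hx]; exact hp'P
  set D := M✶.closure {p} \ {p, p'} with hDdef
  have hDP : D ⊆ M✶.closure {p} := Set.sdiff_subset
  have hpD : p ∉ D := fun h => h.2 (Set.mem_insert p {p'})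
  have hDcard : D.ncard = (M✶.closure {p}).ncard - 2 := by
    rw [hDdef, Set.ncard_sdiff hpair (Set.toFinite _), Set.ncard_pair hp'p.symm]
  have hDne : D.Nonempty := Set.nonempty_of_ncard_ne_zero (by rw [hDcard]; omega)
  obtain ⟨hdual, hcard, -, -, hbM, hcl⟩ := hcut D hDP hpD hDne
  obtain ⟨hnl', hr', hp'', hbP'⟩ := hfam D hDP hpD
  have hcl2 : ((M✶.delete D).closure {p}).ncard = 2 := by
    rw [hcl, hDdef, Set.sdiff_sdiff_cancel_left hpair, Set.ncard_pair hp'p.symm]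
  haveI : (M.contract D).Finite := Matroid.contract_finite
  have hup0 : BiIndepUpAt (M.contract D) b 5 := by
    rcases Nat.lt_or_ge (M.contract D).E.ncard 12 with h11 | h12
    · refine upAt_of_ncard_eq_middle (M.contract D) hbM ?_
      rw [hcard, hDcard]; omega
    · exact hih D hDP hpD hDne h12
  unfold BiIndepUpAt at hup0
  rw [biIndep_eq_biSpan_dual, biIndep_eq_biSpan_dual, hdual] at hup0
  have hup : {W ∈ biSpan (M✶.delete D) 5 | b ∈ W}.ncard ≤ {Z ∈ biSpan (M✶.delete D) 6 | b ∉ Z}.ncard := hup0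
  have hT2 := through_five_eq_rank_five (M✶.delete D) hnl' hr' hp'' (by omega) hbP'
  have hV2 := avoid_six_eq_rank_five_of_two (M✶.delete D) hnl' hr' hp'' hcl2 hbP'
  rw [hcl2, upFull_delete_parallel M✶ hpE hDP hpD, throughHat_delete_parallel M✶ hpE hDP hpD] at hT2
  rw [avoidFull_delete_parallel M✶ hpE hDP hpD, avoidHat_delete_parallel M✶ hpE hDP hpD,
    avoidSp_delete_parallel M✶ hpE hDP hpD] at hV2
  rw [hT2, hV2] at hup
  have hsp : (avoidSp M✶ p b 4).ncard ≤ (avoidHat M✶ p b 4).ncard :=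
    Set.ncard_le_ncard (avoidSp_subset_avoidHat M✶ p b 4) (avoidHat_finite M✶ p b 4)
  obtain ⟨q₂, hq₂⟩ : ∃ q₂, (M✶.closure {p}).ncard = q₂ + 2 := ⟨(M✶.closure {p}).ncard - 2, by omega⟩
  rw [hq₂] at hT hV
  have hc2 : 1 ≤ (q₂ + 2).choose 2 := Nat.choose_pos (by omega)
  have hm1 : q₂ * (throughHat M✶ p b 4).ncard ≤ q₂ * (avoidHat M✶ p b 5).ncard := Nat.mul_le_mul_left q₂ hg4
  have hm2 : 1 * (avoidHat M✶ p b 4).ncard ≤ (q₂ + 2).choose 2 * (avoidHat M✶ p b 4).ncard :=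
    Nat.mul_le_mul_right _ hc2
  rw [hT, hV]
  simp only [Nat.add_mul, Nat.one_mul] at hm2 ⊢
  omega

end PercRepro
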